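import Summits.RiemannHypothesis.RiemannHypothesis.Theorems.HandoffSemilocalDilation
import Summits.RiemannHypothesis.RiemannHypothesis.Theorems.HandoffMarginLaw
import Summits.RiemannHypothesis.RiemannHypothesis.Theorems.SoloInformedNonDegenerate
import HarnessLib

/-!
# TRACK «HANDOFF» — the semi-local bottom is CONTINUOUS in the window; under RH every wall offset is STRICTLY positive (theory-1 gen5, file XI-b)

Cell `rh-explicit`, seat handoff-theory-1 (H-T, statement owner).  `HANDOFF-STATEMENT.md` §B.4 (ii) left OPEN whether the
STRICT lower clause of the cell's C-I(a) — `(log q)/2 < a*({p < q})`, i.e. wall offset `δ*(q) > 0` — follows from RH; it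
was reduced there to (a) `ε((log q)/2) > 0` under RH and (b) right-continuity of the semi-local bottom `t ↦ λ_min(S_{<q}; t)`
at `t = (log q)/2`.  (a) is the Solo programme's `weilGroundEnergy_pos_of_riemannHypothesis` (Yoshida 1992 Thm 2 in
variational form); (b) follows from part 1/2 (`HandoffSemilocalDilation.lean`, the uniform dilation modulus of `Q_S`):

* §4 `continuousAt_semilocalGroundEnergy` / `continuousOn_semilocalGroundEnergy` — **for every finite `S`,
  `t ↦ λ_min(S; t)` is continuous on `(0, ∞)`** (the semi-local twin of `continuousAt_weilGroundEnergy`, Suzuki 2026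
  Thm 1.3); with the tree's antitonicity and closedness: `semilocalGroundEnergy_threshold_eq_zero` — **at the wall the
  bottom vanishes EXACTLY, `λ_min(S; a*(S)) = 0`** (the cell's certified walls `a*(S)` are continuous sign crossings).
* §5 **`log_half_lt_weilSemilocalThreshold_of_riemannHypothesis`: RH ⟹ `(log q)/2 < a*({p < q})` for every prime `q`**,
  `wallOffset_pos_of_riemannHypothesis` (RH ⟹ `δ*(q) > 0`), and
  **`riemannHypothesis_iff_forall_wallOffset_pos : RH ↔ ∀ q prime, 0 < δ*(q)`** — §B.4's non-strict equivalence
  `RH ↔ ∀ q, δ*(q) ≥ 0` (`riemannHypothesis_iff_forall_log_half_le_weilSemilocalThreshold`) sharpened to the STRICT clause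
  the cell measures (`δ*(q) = 0.0250, 0.0080, 0.00251, …` for `q = 2, 3, 5, …`, SEMILOCAL-TABLE): under RH the old form
  survives STRICTLY past `(log q)/2` at every prime.

HONEST FRAMING. Nothing here is a step towards RH: §5 says what RH implies about the walls and restates RH as «all wall
offsets strictly positive»; it makes no wall offset easier to sign.  §4 is an unconditional structural fact about the
tree's semi-local forms (used implicitly whenever a wall is located by a sign change).

References: M. Suzuki, arXiv:2606.09096 (2026) Thm 1.3 (key `Suzuki2026`); H. Yoshida, Adv. Stud. Pure Math. 21 (1992)
281–325, Prop. 6 (p. 320), Thm 2 (p. 321) (key `Yoshida1992HermitianForms`); E. Bombieri, Rend. Mat. Acc. Lincei (9) 11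
(2000) Thm 2, §4 (key `Bombieri2000Weil`); this track (HANDOFF-STATEMENT §B.4).
-/

set_option linter.dupNamespace false  -- the mandated namespace repeats `RiemannHypothesis`

noncomputable section

open Set Filter Complex MeasureTheory Literature.NumberTheory.LFunctions
open Literature.Analysis.SpecialFunctions
open Summit.RiemannHypothesis.RiemannHypothesis.Theorems
open Summit.RiemannHypothesis.RiemannHypothesis.Theorems.MotivicDoor.Semilocal
open Summit.RiemannHypothesis.RiemannHypothesis.Theorems.MotivicDoor.SemilocalThreshold
open Summit.RiemannHypothesis.RiemannHypothesis.Theorems.HandoffDecomposition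
open Summit.RiemannHypothesis.RiemannHypothesis.Theorems.HandoffMarginLaw
open scoped Real Topology ComplexConjugate ArithmeticFunction.vonMangoldt

namespace Summit.RiemannHypothesis.RiemannHypothesis.Theorems.HandoffSemilocalEnergy

variable {S : Finset ℕ} {q : ℕ}

/-! ## §4  Continuity of the semi-local bottom in the window -/

/-- Near-minimisers of the semi-local bottom exist (`a > 0`, `ε > 0`). [folklore] -/
theorem exists_re_weilSemilocalQuadratic_lt (S : Finset ℕ) {a ε : ℝ} (ha : 0 < a) (hε : 0 < ε) :
    ∃ g : ℝ → ℂ, IsWeilTest g ∧ tsupport g ⊆ Icc (-a) a ∧ ∫ t : ℝ, ‖g t‖ ^ 2 = (1 : ℝ) ∧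
      (weilSemilocalQuadratic S g).re < semilocalGroundEnergy S (fun _ ↦ True) a + ε := by
  have hlt : sInf (semilocalSphereValues S (fun _ ↦ True) a) <
      semilocalGroundEnergy S (fun _ ↦ True) a + ε := lt_add_of_pos_right _ hε
  obtain ⟨x, ⟨g, hg, hs, -, hn, rfl⟩, hxlt⟩ :=
    exists_lt_of_csInf_lt (semilocalSphereValues_top_nonempty S ha) hlt
  exact ⟨g, hg, hs, hn, hxlt⟩

/-- **Continuity of the semi-local bottom at every window `a₀ > 0`, for every finite set of primes `S`** (the
semi-local twin of `continuousAt_weilGroundEnergy`, Suzuki 2026 Thm 1.3 for the full form).  Upper bound near `a₀`: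
dilate a near-minimiser of the window `a₀` into the window `a`; lower bound: dilate every energy-bounded element of the
unit sphere of the window `a ≤ 2a₀` into the window `a₀`; both by the uniform modulus `exists_semilocalDilate_modulus`.
[cite: Suzuki2026, Thm. 1.3 (mechanism), with the primes restricted to S; this track (HANDOFF-STATEMENT §B.4 (ii)(b))] -/
theorem continuousAt_semilocalGroundEnergy (S : Finset ℕ) {a₀ : ℝ} (ha₀ : 0 < a₀) :
    ContinuousAt (semilocalGroundEnergy S (fun _ ↦ True)) a₀ := by
  rw [Metric.continuousAt_iff]
  intro ε hε
  obtain ⟨g₀, hg₀, hs₀, hn₀, hlt⟩ := exists_re_weilSemilocalQuadratic_lt S ha₀ (half_pos hε)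
  obtain ⟨δ₁, hδ₁, -, h₁⟩ :=
    exists_semilocalDilate_modulus S ha₀ ((weilSemilocalQuadratic S g₀).re) (half_pos hε)
  obtain ⟨δ₂, hδ₂, -, h₂⟩ :=
    exists_semilocalDilate_modulus S (a := 2 * a₀) (by positivity)
      (semilocalGroundEnergy S (fun _ ↦ True) a₀ + 1) (half_pos hε)
  refine ⟨min (a₀ / 2) (min (δ₁ * a₀ / 2) (δ₂ * a₀ / 2)), by positivity, fun a ha ↦ ?_⟩
  rw [Real.dist_eq] at ha ⊢
  have ha1 : |a - a₀| < a₀ / 2 := lt_of_lt_of_le ha (min_le_left _ _)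
  have ha2 : |a - a₀| < δ₁ * a₀ / 2 := lt_of_lt_of_le ha ((min_le_right _ _).trans (min_le_left _ _))
  have ha3 : |a - a₀| < δ₂ * a₀ / 2 := lt_of_lt_of_le ha ((min_le_right _ _).trans (min_le_right _ _))
  rw [abs_lt] at ha1 ha2 ha3
  have hapos : a₀ / 2 < a := by linarith [ha1.1]
  have ha0 : 0 < a := by linarith
  have hale : a ≤ 2 * a₀ := by linarith [ha1.2]
  rw [abs_sub_lt_iff]
  constructor
  · -- upper bound: `λ(a) < λ(a₀) + ε`
    set η : ℝ := a₀ / a - 1 with hη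
    have hη1 : -1 < η := by
      have : 0 < a₀ / a := div_pos ha₀ ha0
      rw [hη]; linarith
    have hηabs : |η| ≤ δ₁ := by
      rw [hη, show a₀ / a - 1 = (a₀ - a) / a by field_simp, abs_div, abs_of_pos ha0,
        div_le_iff₀ ha0, abs_sub_comm]
      nlinarith [ha2.1, ha2.2, abs_lt.2 ⟨ha2.1, ha2.2⟩]
    have hwin : a₀ / (1 + η) = a := by
      rw [show 1 + η = a₀ / a by rw [hη]; ring, div_div_eq_mul_div, mul_div_cancel_left₀ _ ha₀.ne']
    have hh : IsWeilTest (weilDilate η g₀) := hg₀.weilDilate hη1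
    have hhs : tsupport (weilDilate η g₀) ⊆ Icc (-a) a := by
      have := tsupport_weilDilate_subset g₀ hη1 hs₀
      rwa [hwin] at this
    have hhn : ∫ t : ℝ, ‖weilDilate η g₀ t‖ ^ 2 = 1 := by
      rw [integral_norm_sq_weilDilate g₀ hη1, hn₀]
    have hle := semilocalGroundEnergy_le_re (S := S) (P := fun _ ↦ True) hh hhs trivial hhn
    have hkey := h₁ η hηabs g₀ hg₀ hs₀ hn₀ le_rfl
    rw [abs_le] at hkey
    linarith [hkey.2]
  · -- lower bound: `λ(a₀) − ε < λ(a)`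
    have hlb : semilocalGroundEnergy S (fun _ ↦ True) a₀ - ε / 2 ≤
        semilocalGroundEnergy S (fun _ ↦ True) a := by
      refine le_semilocalGroundEnergy (semilocalSphereValues_top_nonempty S ha0) fun h hh hhs _ hhn ↦ ?_
      by_cases hE : (weilSemilocalQuadratic S h).re ≤ semilocalGroundEnergy S (fun _ ↦ True) a₀ + 1
      · set η : ℝ := a / a₀ - 1 with hη
        have hη1 : -1 < η := by
          have : 0 < a / a₀ := div_pos ha0 ha₀
          rw [hη]; linarith
        have hηabs : |η| ≤ δ₂ := by
          rw [hη, show a / a₀ - 1 = (a - a₀) / a₀ by field_simp, abs_div, abs_of_pos ha₀,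
            div_le_iff₀ ha₀]
          nlinarith [ha3.1, ha3.2, abs_lt.2 ⟨ha3.1, ha3.2⟩]
        have hwin : a / (1 + η) = a₀ := by
          rw [show 1 + η = a / a₀ by rw [hη]; ring, div_div_eq_mul_div,
            mul_div_cancel_left₀ _ ha0.ne']
        have hhs' : tsupport h ⊆ Icc (-(2 * a₀)) (2 * a₀) :=
          hhs.trans (Icc_subset_Icc (by linarith) hale)
        have hh' : IsWeilTest (weilDilate η h) := hh.weilDilate hη1
        have hhs'' : tsupport (weilDilate η h) ⊆ Icc (-a₀) a₀ := by
          have := tsupport_weilDilate_subset h hη1 hhs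
          rwa [hwin] at this
        have hhn' : ∫ t : ℝ, ‖weilDilate η h t‖ ^ 2 = 1 := by
          rw [integral_norm_sq_weilDilate h hη1, hhn]
        have hle := semilocalGroundEnergy_le_re (S := S) (P := fun _ ↦ True) hh' hhs'' trivial hhn'
        have hkey := h₂ η hηabs h hh hhs' hhn hE
        rw [abs_le] at hkey
        linarith [hkey.1]
      · have hE' := not_le.1 hE
        linarith
    linarith

/-- **For every finite `S`, `t ↦ λ_min(S; t)` is continuous on `(0, ∞)`.** [cite: Suzuki2026, Thm. 1.3 (mechanism), with the primes restricted to S] -/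
theorem continuousOn_semilocalGroundEnergy (S : Finset ℕ) :
    ContinuousOn (semilocalGroundEnergy S (fun _ ↦ True)) (Ioi 0) :=
  fun _ ha ↦ (continuousAt_semilocalGroundEnergy S ha).continuousWithinAt

/-- If the bottom is STRICTLY positive at a window `t₀ > 0` then some strictly larger window is still semi-locally
positive, so `t₀ < a*(S)`. [folklore] -/
theorem lt_weilSemilocalThreshold_of_semilocalGroundEnergy_pos {t₀ : ℝ} (ht₀ : 0 < t₀)
    (hpos : 0 < semilocalGroundEnergy S (fun _ ↦ True) t₀) : t₀ < weilSemilocalThreshold S := by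
  have hcont := continuousAt_semilocalGroundEnergy S ht₀
  rw [Metric.continuousAt_iff] at hcont
  obtain ⟨δ, hδ, h⟩ := hcont _ hpos
  have h1 : dist (t₀ + δ / 2) t₀ < δ := by
    rw [Real.dist_eq, show t₀ + δ / 2 - t₀ = δ / 2 by ring, abs_of_pos (half_pos hδ)]
    linarith
  have h2 := h h1
  rw [Real.dist_eq, abs_lt] at h2
  have h3 : 0 ≤ semilocalGroundEnergy S (fun _ ↦ True) (t₀ + δ / 2) := by linarith [h2.1]
  have h4 : t₀ + δ / 2 ≤ weilSemilocalThreshold S := semilocalGroundEnergy_top_nonneg_iff_le_threshold.1 h3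
  linarith

/-- **At the wall the bottom vanishes EXACTLY: `λ_min(S; a*(S)) = 0`** for every finite `S` (`≥ 0` by the closedness of the
positive windows, `weilSemilocalPositivityOn_weilSemilocalThreshold`; `> 0` is excluded by continuity, the windows beyond
the wall being non-positive).  So the cell's certified walls are continuous sign crossings of the continuum bottom.
[cite: Yoshida1992HermitianForms, Prop. 6 (p. 320), with the primes restricted to S; this track] -/
theorem semilocalGroundEnergy_threshold_eq_zero (S : Finset ℕ) :
    semilocalGroundEnergy S (fun _ ↦ True) (weilSemilocalThreshold S) = 0 := by
  have hge : 0 ≤ semilocalGroundEnergy S (fun _ ↦ True) (weilSemilocalThreshold S) :=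
    semilocalGroundEnergy_top_nonneg_iff_le_threshold.2 le_rfl
  by_contra hne
  have hpos : 0 < semilocalGroundEnergy S (fun _ ↦ True) (weilSemilocalThreshold S) :=
    lt_of_le_of_ne hge (Ne.symm hne)
  exact absurd (lt_weilSemilocalThreshold_of_semilocalGroundEnergy_pos (weilSemilocalThreshold_pos S) hpos)
    (lt_irrefl _)

/-! ## §5  Under RH every wall offset is STRICTLY positive; `RH ↔ ∀ q, δ*(q) > 0` -/

/-- **RH ⟹ `(log q)/2 < a*({p < q})` for every prime `q`** — the STRICT lower clause of the cell's C-I(a)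
(`HANDOFF-STATEMENT.md` §B.4 (ii), previously OPEN): at `t₀ = (log q)/2` the `{p < q}`-form IS Weil's form
(`semilocalGroundEnergy_old_cone`), whose bottom is `> 0` under RH (`weilGroundEnergy_pos_of_riemannHypothesis`,
Yoshida Thm 2 in variational form), and the semi-local bottom is continuous there (§4).
[cite: Yoshida1992HermitianForms, Thm. 2 (p. 321), Prop. 6 (p. 320); this track (HANDOFF-STATEMENT §B.4 (ii))] -/
theorem log_half_lt_weilSemilocalThreshold_of_riemannHypothesis (hRH : Summit.RiemannHypothesis) (hq : q.Prime) :
    Real.log q / 2 < weilSemilocalThreshold (Nat.primesBelow q) := by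
  have ht₀ : 0 < Real.log q / 2 := by
    have := Real.log_pos (show (1 : ℝ) < q by exact_mod_cast hq.one_lt)
    positivity
  refine lt_weilSemilocalThreshold_of_semilocalGroundEnergy_pos ht₀ ?_
  rw [semilocalGroundEnergy_old_cone hq le_rfl]
  exact weilGroundEnergy_pos_of_riemannHypothesis hRH ht₀

/-- **RH ⟹ every wall offset is strictly positive**: `0 < δ*(q) = a*({p < q}) − (log q)/2` for every prime `q`
(`wallOffset`, `HandoffMarginLaw.lean`). [cite: Yoshida1992HermitianForms, Thm. 2, Prop. 6; this track] -/
theorem wallOffset_pos_of_riemannHypothesis (hRH : Summit.RiemannHypothesis) (hq : q.Prime) :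
    0 < wallOffset q := by
  unfold wallOffset
  linarith [log_half_lt_weilSemilocalThreshold_of_riemannHypothesis hRH hq]

/-- **`RH ↔ ∀ q prime, (log q)/2 < a*({p < q})`** — the wall-offset form of the target (§B.4,
`riemannHypothesis_iff_forall_log_half_le_weilSemilocalThreshold`) with the STRICT inequality.
[cite: Yoshida1992HermitianForms, Prop. 6, Thm. 2; Bombieri2000Weil Thm. 2; this track] -/
theorem riemannHypothesis_iff_forall_log_half_lt_weilSemilocalThreshold :
    Summit.RiemannHypothesis ↔
      ∀ q : ℕ, q.Prime → Real.log q / 2 < weilSemilocalThreshold (Nat.primesBelow q) :=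
  ⟨fun h _ hq ↦ log_half_lt_weilSemilocalThreshold_of_riemannHypothesis h hq,
    fun h ↦ riemannHypothesis_iff_forall_log_half_le_weilSemilocalThreshold.2 fun q hq ↦ (h q hq).le⟩

/-- **`RH ↔` every wall offset `δ*(q)` is STRICTLY positive** (the cell's C-I(a) lower clause, strict form, for every
prime, is exactly RH). [cite: Yoshida1992HermitianForms, Prop. 6, Thm. 2; Bombieri2000Weil Thm. 2; this track] -/
theorem riemannHypothesis_iff_forall_wallOffset_pos :
    Summit.RiemannHypothesis ↔ ∀ q : ℕ, q.Prime → 0 < wallOffset q := by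
  rw [riemannHypothesis_iff_forall_log_half_lt_weilSemilocalThreshold]
  refine forall_congr' fun q ↦ forall_congr' fun _ ↦ ?_
  unfold wallOffset
  constructor <;> intro h <;> linarith

end Summit.RiemannHypothesis.RiemannHypothesis.Theorems.HandoffSemilocalEnergy

end
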